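import Mathlib
import HarnessLib
import Summits.HubbardSuperconductivity.HubbardSuperconductivity.Theorems.KLProgrammeKLRegimeTwoVolumeFrameDefect
import Summits.HubbardSuperconductivity.HubbardSuperconductivity.Theorems.KLProgrammeKLRegimeTwoVolumeTowerBaseDefs

/-!
# Route `KLProgramme` — crux K3, VL child `KLRegimeVolumeLimitV17F2` (stmt-HubbardSuperconductivity-20440), atom HB1, GRID HALF (assembly step G3-1):
# THE FINE-LATTICE FRAME-SWAP DATA OF THE `Λ₁` GRID COVARIANCE IN THE GRID SCALING, FROM THE TOWER — fields `hsE`, `hR`, `hCc` of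
# `…TowerBaseGridDataDDefs.TowerGridDataD` with rates `sE L = cc L = Csw/L` (cell gate-hubbard-kl, seat p3 g18; `--supports` 20440)

The data package `TowerGridDataD L b M …` of the grid-level base (consumer `…TowerBaseGridLimitDeg`) asks, on the fine lattice `bL` with `N = 4M` grid times,
for the entry sup `≤ sE` and the `ε`-SCALED row and column sums `≤ cc` (`ε = imagTimeWeight β M = β/(2M)`) of the frame swap
`E = Sᵀ C^{K_{bL}}_{>Λ₁} S − Sᵀ C^{K_L}_{>Λ₁} S` of the `Λ₁`-grid covariance between the two volumes' top flow frames, with `sE, cc → 0` in `L`.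
k3c5-p3's `…TwoVolumeFrameDefect` (§4, from the Literature layer `HubbardUVCovarianceCTFrameDefect`) bounds the UNSCALED rows on any grid by the weighted-Plancherel
constant with a free time scale `s₀`; here we take `s₀ := β/M`, multiply by `ε`, and do the bookkeeping: the `M`-growth `√M·√M` of the prefactor and of the
`N = 4M` grid factor is exactly cancelled by `ε`, and every symbol term — including the time-EDGE term, which carries `1/(2M−3)⁴ ≤ 1` — carries
`(c_j(n_β+1)/L)²`:

* §1 `eps_mul_frameSwapRow_le` — the real-number bookkeeping (generic in the nonnegative atoms);
* §2 **`frameSwap_gridDataD_of_towerV17F2`** — under `TowerP klPredsV17F2 …` (`μ ∈ klWindowC`, `1 ≤ β`): `∃ Csw ≥ 0` such that for all `L ≥ Lstar`, all `b`,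
  all `M` with `Mstar L, Q.M0 β L, Mstar (bL), Q.M0 β (bL) ≤ M`, `2 ≤ M`: entries `≤ Csw/L`, `ε·rows ≤ Csw/L`, `ε·columns ≤ Csw/L`
  — literally the fields `hsE/hR/hCc` at `sE L = cc L = Csw/L`.

Proofs only; no definition.  Honest framing: bookkeeping over landed bounds; nothing here asserts HB1, any stub of 20440, K3, VL or superconductivity.
[cite: BenfattoGiulianiMastropietro2006, §2.2 (2.23), §2.8 (2.80)–(2.81), §3 (3.3)]
-/

noncomputable section

namespace Summit.HubbardSuperconductivity.HubbardSuperconductivity.Theorems.TwoVolumeSource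

set_option linter.dupNamespace false -- summit = problem name (single-conjunct summit), D-0017

open Finset Literature.MathematicalPhysics.QuantumLattice Literature.Probability.LatticeModels
open Literature.MathematicalPhysics.QuantumLattice.FermiRG
open Summit.HubbardSuperconductivity.HubbardSuperconductivity.Theorems.DispersionFlow
open Summit.HubbardSuperconductivity.HubbardSuperconductivity.Theorems.KLRegimeSplit
open Summit.HubbardSuperconductivity.HubbardSuperconductivity.Theorems.KLProgrammeLegKernels
open Summit.HubbardSuperconductivity.HubbardSuperconductivity.Theorems.EngineV8
open Summit.HubbardSuperconductivity.HubbardSuperconductivity.Theorems.TwoPointAssembly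
open Summit.HubbardSuperconductivity.HubbardSuperconductivity.Theorems.TwoVolumeDefect
open scoped Real

/-! ## §1 The bookkeeping: `ε × (two-frame decay constant at s₀ = β/M) ≤ √K / L` -/

/-- **`ε`-SCALED TWO-FRAME ROW CONSTANT** (generic atoms): with `ε = β/(2M)`, `s₀ = β/M`, `N = 4M` grid times, fine volume `N₂ = b·L`, band-distance
data `c_j/L` and `M ≥ 2`, the row constant of `HubbardUVCovarianceCTFrameDefect` times `ε` is `≤ √K/L` with `K` free of
`L, b, M`. [cite: BenfattoGiulianiMastropietro2006, §2.8 (2.80)–(2.81)] -/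
theorem eps_mul_frameSwapRow_le {β Mr Lr N₂ Ng Λ A B C2 C3 c₀ c₁ c₂ : ℝ} (hβ : 1 ≤ β) (hMr2 : 2 ≤ Mr) (hLr0 : 0 < Lr) (hN₂0 : 0 < N₂)
    (hNg : Ng = 4 * Mr) (hΛ : 0 < Λ) :
    β / (2 * Mr) * (Real.sqrt ((2 + 12 / (β / Mr)) * 14 ^ 2) *
      Real.sqrt (Ng ^ 1 * N₂ ^ 2 *
        (N₂ ^ 2 * ((1 / (β * N₂ ^ 2)) ^ 4 * (β * N₂ ^ 2) ^ 2 * (A * (c₀ / Lr)) ^ 2 * ((2 / Λ) ^ (2 * 1) * (2 * β / Λ))) +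
          (Ng * (β / Mr) / 4) ^ 4 *
            (N₂ ^ 2 * ((1 / (β * N₂ ^ 2)) ^ 4 * (β * N₂ ^ 2) ^ 2 * (2 * π / β) ^ 4 * (B * (c₀ / Lr)) ^ 2 *
                (4 ^ 4 * ((2 / Λ) ^ (2 * 4 - 2) * (2 * β / Λ)) + 4 * ((2 : ℕ) : ℝ) * (2 / Λ) ^ (2 * 4))) +
              4 * (N₂ ^ 2 * (4 * ((1 / (β * N₂ ^ 2)) ^ 2 * (β * N₂ ^ 2 * (A * (c₀ / Lr) * (β / (π * (2 * Mr - 3))) ^ 2)))) ^ 2)) +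
          2 * ((N₂ / 4) ^ 4 * (N₂ ^ 2 * ((1 / (β * N₂ ^ 2)) ^ 4 * (β * N₂ ^ 2) ^ 2 * (2 * π / N₂) ^ 4 *
              (C3 * (2 / Λ) ^ 2 * 7 ^ 2 * (c₀ / Lr) + C2 * (2 / Λ) * (7 * (c₀ / Lr) + 2 * 7 * (c₁ / Lr)) + A * (c₂ / Lr)) ^ 2 *
                ((2 / Λ) ^ (2 * 1) * (2 * β / Λ)))))))) ≤
      Real.sqrt (2744 * β ^ 2 *
        ((A * c₀) ^ 2 * ((2 / Λ) ^ (2 * 1) * (2 * β / Λ)) / β ^ 2 +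
          β ^ 2 * (2 * π / β) ^ 4 * (B * c₀) ^ 2 * (4 ^ 4 * ((2 / Λ) ^ (2 * 4 - 2) * (2 * β / Λ)) + 4 * ((2 : ℕ) : ℝ) * (2 / Λ) ^ (2 * 4)) +
          64 * A ^ 2 * β ^ 6 * c₀ ^ 2 / π ^ 4 +
          π ^ 4 / 8 * (C3 * (2 / Λ) ^ 2 * 7 ^ 2 * c₀ + C2 * (2 / Λ) * (7 * c₀ + 2 * 7 * c₁) + A * c₂) ^ 2 * ((2 / Λ) ^ (2 * 1) * (2 * β / Λ)) / β ^ 2)) / Lr := by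
  have hπ := Real.pi_pos
  have hβ0 : 0 < β := by linarith
  have hMr : 1 ≤ Mr := by linarith
  have hMr0 : 0 < Mr := by linarith
  have hM3 : 1 ≤ 2 * Mr - 3 := by linarith
  have hM30 : 0 < 2 * Mr - 3 := by linarith
  -- the time-edge term carries `1/(2Mr − 3)⁴ ≤ 1`
  have hedge4 : 1 / (2 * Mr - 3) ^ 4 ≤ 1 := by
    rw [div_le_one (by positivity)]
    exact one_le_pow₀ hM3
  -- the prefactor: `ε²·(2 + 12M/β)·14²·N ≤ 2744β²`
  have hP : (β / (2 * Mr)) ^ 2 * ((2 + 12 / (β / Mr)) * 14 ^ 2) * Ng ^ 1 ≤ 2744 * β ^ 2 := by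
    rw [hNg]
    have hid : (β / (2 * Mr)) ^ 2 * ((2 + 12 / (β / Mr)) * 14 ^ 2) * (4 * Mr) ^ 1 = 392 * β ^ 2 / Mr + 2352 * β := by
      field_simp
      ring
    rw [hid]
    have h1 : 392 * β ^ 2 / Mr ≤ 392 * β ^ 2 := div_le_self (by positivity) hMr
    have h2 : β ≤ β ^ 2 := by rw [sq]; exact le_mul_of_one_le_right hβ0.le hβ
    linarith
  have hX : Ng * (β / Mr) / 4 = β := by
    rw [hNg]
    field_simp
  -- names for the pieces
  set T0 : ℝ := N₂ ^ 2 * ((1 / (β * N₂ ^ 2)) ^ 4 * (β * N₂ ^ 2) ^ 2 * (A * (c₀ / Lr)) ^ 2 * ((2 / Λ) ^ (2 * 1) * (2 * β / Λ))) with hT0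
  set T1m : ℝ := N₂ ^ 2 * ((1 / (β * N₂ ^ 2)) ^ 4 * (β * N₂ ^ 2) ^ 2 * (2 * π / β) ^ 4 * (B * (c₀ / Lr)) ^ 2 *
      (4 ^ 4 * ((2 / Λ) ^ (2 * 4 - 2) * (2 * β / Λ)) + 4 * ((2 : ℕ) : ℝ) * (2 / Λ) ^ (2 * 4))) with hT1m
  set T1e : ℝ := 4 * (N₂ ^ 2 * (4 * ((1 / (β * N₂ ^ 2)) ^ 2 * (β * N₂ ^ 2 * (A * (c₀ / Lr) * (β / (π * (2 * Mr - 3))) ^ 2)))) ^ 2) with hT1e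
  set T2 : ℝ := (N₂ / 4) ^ 4 * (N₂ ^ 2 * ((1 / (β * N₂ ^ 2)) ^ 4 * (β * N₂ ^ 2) ^ 2 * (2 * π / N₂) ^ 4 *
      (C3 * (2 / Λ) ^ 2 * 7 ^ 2 * (c₀ / Lr) + C2 * (2 / Λ) * (7 * (c₀ / Lr) + 2 * 7 * (c₁ / Lr)) + A * (c₂ / Lr)) ^ 2 *
        ((2 / Λ) ^ (2 * 1) * (2 * β / Λ)))) with hT2
  set K0 : ℝ := (A * c₀) ^ 2 * ((2 / Λ) ^ (2 * 1) * (2 * β / Λ)) / β ^ 2 with hK0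
  set K1 : ℝ := β ^ 2 * (2 * π / β) ^ 4 * (B * c₀) ^ 2 * (4 ^ 4 * ((2 / Λ) ^ (2 * 4 - 2) * (2 * β / Λ)) + 4 * ((2 : ℕ) : ℝ) * (2 / Λ) ^ (2 * 4))
    with hK1
  set K1e : ℝ := 64 * A ^ 2 * β ^ 6 * c₀ ^ 2 / π ^ 4 with hK1e
  set K2 : ℝ := π ^ 4 / 8 * (C3 * (2 / Λ) ^ 2 * 7 ^ 2 * c₀ + C2 * (2 / Λ) * (7 * c₀ + 2 * 7 * c₁) + A * c₂) ^ 2 *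
      ((2 / Λ) ^ (2 * 1) * (2 * β / Λ)) / β ^ 2 with hK2
  -- nonnegativity
  have hT0n : 0 ≤ T0 := by positivity
  have hT1mn : 0 ≤ T1m := by positivity
  have hT1en : 0 ≤ T1e := by positivity
  have hT2n : 0 ≤ T2 := by positivity
  have hK0n : 0 ≤ K0 := by positivity
  have hK1n : 0 ≤ K1 := by positivity
  have hK1en : 0 ≤ K1e := by positivity
  have hK2n : 0 ≤ K2 := by positivity
  -- (i) the scaling identities and the edge bound
  have e0 : N₂ ^ 2 * T0 = K0 / Lr ^ 2 := by
    rw [hT0, hK0]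
    field_simp
  have e1 : N₂ ^ 2 * (β ^ 4 * T1m) = K1 / Lr ^ 2 := by
    rw [hT1m, hK1]
    field_simp
  have e2 : N₂ ^ 2 * (2 * T2) = K2 / Lr ^ 2 := by
    rw [hT2, hK2]
    field_simp
    ring
  have e1e : N₂ ^ 2 * (β ^ 4 * T1e) ≤ K1e / Lr ^ 2 := by
    -- `N₂²β⁴T1e = (64A²β⁶c₀²/π⁴)/Lr² · 1/(2Mr−3)⁴`
    have hid : N₂ ^ 2 * (β ^ 4 * T1e) = 64 * A ^ 2 * β ^ 6 * c₀ ^ 2 / π ^ 4 / Lr ^ 2 * (1 / (2 * Mr - 3) ^ 4) := by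
      rw [hT1e]
      field_simp
      ring
    rw [hid, hK1e]
    exact mul_le_of_le_one_right (by positivity) hedge4
  -- (ii) the volume factor: `N₂²·S ≤ (K0 + K1 + K1e + K2)/Lr²`
  have hS : N₂ ^ 2 * (T0 + (Ng * (β / Mr) / 4) ^ 4 * (T1m + T1e) + 2 * T2) ≤ (K0 + K1 + K1e + K2) / Lr ^ 2 := by
    rw [hX]
    have hsplit : N₂ ^ 2 * (T0 + β ^ 4 * (T1m + T1e) + 2 * T2) =
        N₂ ^ 2 * T0 + N₂ ^ 2 * (β ^ 4 * T1m) + N₂ ^ 2 * (β ^ 4 * T1e) + N₂ ^ 2 * (2 * T2) := by ring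
    rw [hsplit, e0, e1, e2, add_div, add_div, add_div]
    linarith
  -- (iv) assemble with the pieces frozen (keeps `positivity`/`linarith` away from the large definitions): square both sides
  clear e0 e1 e2 e1e
  clear_value T0 T1m T1e T2 K0 K1 K1e K2
  clear hT0 hT1m hT1e hT2 hK0 hK1 hK1e hK2
  have hPn : 0 ≤ (2 + 12 / (β / Mr)) * 14 ^ 2 := by positivity
  have hSn : 0 ≤ T0 + (Ng * (β / Mr) / 4) ^ 4 * (T1m + T1e) + 2 * T2 := by rw [hX]; positivity
  have hQn : 0 ≤ Ng ^ 1 * N₂ ^ 2 * (T0 + (Ng * (β / Mr) / 4) ^ 4 * (T1m + T1e) + 2 * T2) := by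
    rw [hNg] at hSn ⊢
    positivity
  have hKn : 0 ≤ 2744 * β ^ 2 * (K0 + K1 + K1e + K2) := by positivity
  have hlhs0 : 0 ≤ β / (2 * Mr) * (Real.sqrt ((2 + 12 / (β / Mr)) * 14 ^ 2) *
      Real.sqrt (Ng ^ 1 * N₂ ^ 2 * (T0 + (Ng * (β / Mr) / 4) ^ 4 * (T1m + T1e) + 2 * T2))) := by positivity
  have hrhs0 : 0 ≤ Real.sqrt (2744 * β ^ 2 * (K0 + K1 + K1e + K2)) / Lr := by positivity
  rw [← pow_le_pow_iff_left₀ hlhs0 hrhs0 two_ne_zero]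
  have hl : (β / (2 * Mr) * (Real.sqrt ((2 + 12 / (β / Mr)) * 14 ^ 2) *
      Real.sqrt (Ng ^ 1 * N₂ ^ 2 * (T0 + (Ng * (β / Mr) / 4) ^ 4 * (T1m + T1e) + 2 * T2)))) ^ 2 =
      (β / (2 * Mr)) ^ 2 * ((2 + 12 / (β / Mr)) * 14 ^ 2 * (Ng ^ 1 * N₂ ^ 2 * (T0 + (Ng * (β / Mr) / 4) ^ 4 * (T1m + T1e) + 2 * T2))) := by
    rw [mul_pow, mul_pow, Real.sq_sqrt hPn, Real.sq_sqrt hQn]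
  have hr : (Real.sqrt (2744 * β ^ 2 * (K0 + K1 + K1e + K2)) / Lr) ^ 2 = 2744 * β ^ 2 * (K0 + K1 + K1e + K2) / Lr ^ 2 := by
    rw [div_pow, Real.sq_sqrt hKn]
  rw [hl, hr]
  calc (β / (2 * Mr)) ^ 2 * ((2 + 12 / (β / Mr)) * 14 ^ 2 * (Ng ^ 1 * N₂ ^ 2 * (T0 + (Ng * (β / Mr) / 4) ^ 4 * (T1m + T1e) + 2 * T2)))
      = ((β / (2 * Mr)) ^ 2 * ((2 + 12 / (β / Mr)) * 14 ^ 2) * Ng ^ 1) * (N₂ ^ 2 * (T0 + (Ng * (β / Mr) / 4) ^ 4 * (T1m + T1e) + 2 * T2)) := by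
        ring
    _ ≤ (2744 * β ^ 2) * ((K0 + K1 + K1e + K2) / Lr ^ 2) := mul_le_mul hP hS (mul_nonneg (sq_nonneg _) hSn) (by positivity)
    _ = 2744 * β ^ 2 * (K0 + K1 + K1e + K2) / Lr ^ 2 := by ring

/-! ## §2 The fields `hsE`, `hR`, `hCc` of `TowerGridDataD` from the tower -/

section Tower

variable {G : GeoConsts} {P : SplitConsts} {Q : EngConsts} {R : RenConsts} {β U μ : ℝ} {K₀ : TrigPolyC4v} {Lstar : ℕ} {Mstar : ℕ → ℕ}

/-- **THE FINE-LATTICE FRAME-SWAP DATA OF THE `Λ₁` GRID COVARIANCE, GRID SCALING, FROM THE TOWER**: under `TowerP klPredsV17F2 …`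
(`μ ∈ klWindowC`, `1 ≤ β`) there is `Csw ≥ 0` (depending on `β`, `Q` only through `Λ₁`, the `uvMixedConst`s and the (E3f-F) rate sums
`Σ_{m ≤ n_β} 4(2d_m+1)(1+4d_m)^j·Q.CL β m`) such that for all `L ≥ Lstar`, all `b`, all cutoffs `M` above the tower thresholds of BOTH volumes with `2 ≤ M` and
(no further coupling of `M` to `b, L`): the entries, the `ε`-scaled rows and the `ε`-scaled columns of `Sᵀ C^{K_{bL}}_{>Λ₁} S − Sᵀ C^{K_L}_{>Λ₁} S` on the fine lattice `bL` with
`N = 4M` grid times are all `≤ Csw/L` — the fields `hsE/hR/hCc` of `TowerGridDataD` at `sE L = cc L = Csw/L`.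
[cite: BenfattoGiulianiMastropietro2006, §2.2 (2.23), §2.8 (2.80)–(2.81), §3 (3.3)] -/
theorem frameSwap_gridDataD_of_towerV17F2 (hμ : μ ∈ klWindowC) (hβ1 : 1 ≤ β) (hT : TowerP klPredsV17F2 G P Q R β U μ K₀ Lstar Mstar) :
    ∃ Csw : ℝ, 0 ≤ Csw ∧ ∀ (L b M : ℕ) [NeZero L] [NeZero (b * L)] [NeZero M],
      Lstar ≤ L → Mstar L ≤ M → Q.M0 β L ≤ M → Mstar (b * L) ≤ M → Q.M0 β (b * L) ≤ M → 2 ≤ M →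
      (∀ x y, ‖((hubbardGridSub (b * L) M β (klGridN M)).transpose *
            hubbardCovAboveCT (b * L) M β μ 0 (klFlowFrameU (b * L) M β U μ (nScales β + 1)) (klScale klE0 1) * hubbardGridSub (b * L) M β (klGridN M) -
          (hubbardGridSub (b * L) M β (klGridN M)).transpose *
            hubbardCovAboveCT (b * L) M β μ 0 (klFlowFrameU L M β U μ (nScales β + 1)) (klScale klE0 1) * hubbardGridSub (b * L) M β (klGridN M)) x y‖ ≤
          Csw / L) ∧
      (∀ x, imagTimeWeight β M * ∑ y, ‖((hubbardGridSub (b * L) M β (klGridN M)).transpose *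
            hubbardCovAboveCT (b * L) M β μ 0 (klFlowFrameU (b * L) M β U μ (nScales β + 1)) (klScale klE0 1) * hubbardGridSub (b * L) M β (klGridN M) -
          (hubbardGridSub (b * L) M β (klGridN M)).transpose *
            hubbardCovAboveCT (b * L) M β μ 0 (klFlowFrameU L M β U μ (nScales β + 1)) (klScale klE0 1) * hubbardGridSub (b * L) M β (klGridN M)) x y‖ ≤
          Csw / L) ∧
      (∀ y, imagTimeWeight β M * ∑ x, ‖((hubbardGridSub (b * L) M β (klGridN M)).transpose *
            hubbardCovAboveCT (b * L) M β μ 0 (klFlowFrameU (b * L) M β U μ (nScales β + 1)) (klScale klE0 1) * hubbardGridSub (b * L) M β (klGridN M) -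
          (hubbardGridSub (b * L) M β (klGridN M)).transpose *
            hubbardCovAboveCT (b * L) M β μ 0 (klFlowFrameU L M β U μ (nScales β + 1)) (klScale klE0 1) * hubbardGridSub (b * L) M β (klGridN M)) x y‖ ≤
          Csw / L) := by
  have hβ : 0 < β := by linarith
  have hΛ : (0 : ℝ) < klScale klE0 1 := by unfold klScale klE0; positivity
  have hπ := Real.pi_pos
  set Λ : ℝ := klScale klE0 1 with hΛdef
  set A : ℝ := uvMixedConst Λ 0 1 with hA
  set B : ℝ := uvMixedConst Λ 2 1 with hB
  set C3 : ℝ := uvMixedConst Λ 0 3 with hC3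
  set C2 : ℝ := uvMixedConst Λ 0 2 with hC2
  set c₀' : ℝ := ∑ m ∈ range (nScales β + 1), Q.CL β m with hc₀'
  set c₀ : ℝ := ∑ m ∈ range (nScales β + 1), 4 * (2 * (klFlowDeg m : ℝ) + 1) * (1 + 4 * (klFlowDeg m : ℝ)) ^ 0 * Q.CL β m with hc₀
  set c₁ : ℝ := ∑ m ∈ range (nScales β + 1), 4 * (2 * (klFlowDeg m : ℝ) + 1) * (1 + 4 * (klFlowDeg m : ℝ)) ^ 1 * Q.CL β m with hc₁
  set c₂ : ℝ := ∑ m ∈ range (nScales β + 1), 4 * (2 * (klFlowDeg m : ℝ) + 1) * (1 + 4 * (klFlowDeg m : ℝ)) ^ 2 * Q.CL β m with hc₂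
  set K : ℝ := 2744 * β ^ 2 *
        ((A * c₀) ^ 2 * ((2 / Λ) ^ (2 * 1) * (2 * β / Λ)) / β ^ 2 +
          β ^ 2 * (2 * π / β) ^ 4 * (B * c₀) ^ 2 * (4 ^ 4 * ((2 / Λ) ^ (2 * 4 - 2) * (2 * β / Λ)) + 4 * ((2 : ℕ) : ℝ) * (2 / Λ) ^ (2 * 4)) +
          64 * A ^ 2 * β ^ 6 * c₀ ^ 2 / π ^ 4 +
          π ^ 4 / 8 * (C3 * (2 / Λ) ^ 2 * 7 ^ 2 * c₀ + C2 * (2 / Λ) * (7 * c₀ + 2 * 7 * c₁) + A * c₂) ^ 2 * ((2 / Λ) ^ (2 * 1) * (2 * β / Λ)) / β ^ 2)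
    with hK
  refine ⟨max (2 * A * c₀' / Λ) 0 + Real.sqrt K, add_nonneg (le_max_right _ _) (Real.sqrt_nonneg _),
    fun L b M _ _ _ hLs hMs hM0 hMsb hM0b hM2 => ?_⟩
  have hb1 : 1 ≤ b := Nat.pos_of_ne_zero fun hb => NeZero.ne (b * L) (by rw [hb, Nat.zero_mul])
  have hLbL : L ≤ b * L := Nat.le_mul_of_pos_left L hb1
  have hL0 : (0 : ℝ) < L := Nat.cast_pos.2 (Nat.pos_of_ne_zero (NeZero.ne L))
  have hL1 : (1 : ℝ) ≤ L := by exact_mod_cast Nat.pos_of_ne_zero (NeZero.ne L)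
  have hM2r : (2 : ℝ) ≤ M := by exact_mod_cast hM2
  have hM0r : (0 : ℝ) < M := by linarith
  have hN₂ : ((b * L : ℕ) : ℝ) = (b : ℝ) * L := by push_cast; ring
  have hN₂0 : (0 : ℝ) < ((b * L : ℕ) : ℝ) := by rw [hN₂]; exact_mod_cast Nat.mul_pos hb1 (Nat.pos_of_ne_zero (NeZero.ne L))
  have hNg : ((klGridN M : ℕ) : ℝ) = 4 * (M : ℝ) := by simp only [klGridN]; push_cast; ring
  have hMN : 2 * M ≤ klGridN M := by simp only [klGridN]; omega
  have hs₀ : (0 : ℝ) < β / M := by positivity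
  have hε : imagTimeWeight β M = β / (2 * (M : ℝ)) := rfl
  have hε0 : 0 ≤ imagTimeWeight β M := by rw [hε]; positivity
  -- the bookkeeping constant
  have hkey := eps_mul_frameSwapRow_le (A := A) (B := B) (C2 := C2) (C3 := C3) (c₀ := c₀) (c₁ := c₁) (c₂ := c₂)
    hβ1 hM2r hL0 hN₂0 hNg hΛ
  have hKle : Real.sqrt K / L ≤ (max (2 * A * c₀' / Λ) 0 + Real.sqrt K) / L :=
    div_le_div_of_nonneg_right (le_add_of_nonneg_left (le_max_right _ _)) hL0.le
  refine ⟨fun x y => ?_, fun x => ?_, fun y => ?_⟩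
  · -- the entry sup, from `norm_frameDefect_apply_le_of_towerV17F2`
    rw [Matrix.sub_apply, norm_sub_rev, ← Matrix.sub_apply]
    have h := norm_frameDefect_apply_le_of_towerV17F2 hμ hβ hT hLs hLbL hMs hM0 hMsb hM0b (le_refl (nScales β + 1)) hΛ
      (L₂ := b * L) (Mc := M) (Ng := klGridN M) hMN x y
    rw [← hA, ← hc₀'] at h
    have hid : ((b * L : ℕ) : ℝ) ^ 2 * ((1 / (β * ((b * L : ℕ) : ℝ) ^ 2)) ^ 2 * (β * ((b * L : ℕ) : ℝ) ^ 2) * (A * (c₀' / L)) *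
        ((2 / Λ) ^ (2 * 0) * (2 * β / Λ))) = 2 * A * c₀' / Λ / L := by
      rw [mul_zero, pow_zero, one_mul]
      field_simp
    rw [hid] at h
    refine h.trans (le_trans ?_ (div_le_div_of_nonneg_right (le_add_of_nonneg_right (Real.sqrt_nonneg K)) hL0.le))
    exact div_le_div_of_nonneg_right (le_max_left _ _) hL0.le
  · -- the `ε`-scaled rows, from `rowSum_frameDefect_le_of_towerV17F2` at `s₀ = β/M`
    have h := rowSum_frameDefect_le_of_towerV17F2 hμ hβ hT hLs hLbL hMs hM0 hMsb hM0b (le_refl (nScales β + 1)) hΛ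
      (L₂ := b * L) (Mc := M) (Ng := klGridN M) hM2 hMN hs₀ x
    rw [← hA, ← hB, ← hC2, ← hC3, ← hc₀, ← hc₁, ← hc₂] at h
    have hsym : ∀ y, ‖((hubbardGridSub (b * L) M β (klGridN M)).transpose *
            hubbardCovAboveCT (b * L) M β μ 0 (klFlowFrameU (b * L) M β U μ (nScales β + 1)) Λ * hubbardGridSub (b * L) M β (klGridN M) -
          (hubbardGridSub (b * L) M β (klGridN M)).transpose *
            hubbardCovAboveCT (b * L) M β μ 0 (klFlowFrameU L M β U μ (nScales β + 1)) Λ * hubbardGridSub (b * L) M β (klGridN M)) x y‖ =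
        ‖((hubbardGridSub (b * L) M β (klGridN M)).transpose *
            hubbardCovAboveCT (b * L) M β μ 0 (klFlowFrameU L M β U μ (nScales β + 1)) Λ * hubbardGridSub (b * L) M β (klGridN M) -
          (hubbardGridSub (b * L) M β (klGridN M)).transpose *
            hubbardCovAboveCT (b * L) M β μ 0 (klFlowFrameU (b * L) M β U μ (nScales β + 1)) Λ * hubbardGridSub (b * L) M β (klGridN M)) x y‖ :=
      fun y => by rw [Matrix.sub_apply, norm_sub_rev, ← Matrix.sub_apply]
    simp_rw [hsym]
    rw [hε]
    exact ((mul_le_mul_of_nonneg_left h (by positivity)).trans hkey).trans hKle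
  · -- the `ε`-scaled columns
    have h := colSum_frameDefect_le_of_towerV17F2 hμ hβ hT hLs hLbL hMs hM0 hMsb hM0b (le_refl (nScales β + 1)) hΛ
      (L₂ := b * L) (Mc := M) (Ng := klGridN M) hM2 hMN hs₀ y
    rw [← hA, ← hB, ← hC2, ← hC3, ← hc₀, ← hc₁, ← hc₂] at h
    have hsym : ∀ x, ‖((hubbardGridSub (b * L) M β (klGridN M)).transpose *
            hubbardCovAboveCT (b * L) M β μ 0 (klFlowFrameU (b * L) M β U μ (nScales β + 1)) Λ * hubbardGridSub (b * L) M β (klGridN M) -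
          (hubbardGridSub (b * L) M β (klGridN M)).transpose *
            hubbardCovAboveCT (b * L) M β μ 0 (klFlowFrameU L M β U μ (nScales β + 1)) Λ * hubbardGridSub (b * L) M β (klGridN M)) x y‖ =
        ‖((hubbardGridSub (b * L) M β (klGridN M)).transpose *
            hubbardCovAboveCT (b * L) M β μ 0 (klFlowFrameU L M β U μ (nScales β + 1)) Λ * hubbardGridSub (b * L) M β (klGridN M) -
          (hubbardGridSub (b * L) M β (klGridN M)).transpose *
            hubbardCovAboveCT (b * L) M β μ 0 (klFlowFrameU (b * L) M β U μ (nScales β + 1)) Λ * hubbardGridSub (b * L) M β (klGridN M)) x y‖ :=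
      fun x => by rw [Matrix.sub_apply, norm_sub_rev, ← Matrix.sub_apply]
    simp_rw [hsym]
    rw [hε]
    exact ((mul_le_mul_of_nonneg_left h (by positivity)).trans hkey).trans hKle

end Tower

end Summit.HubbardSuperconductivity.HubbardSuperconductivity.Theorems.TwoVolumeSource

end
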